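import Literature.Computability.AlgebraicComplexity.ABV17CubicSurfaceProofs
import HarnessLib

/-!
# Alper–Bogart–Velasco 2017, Remark 1.9: the determinantal complexity is not upper
semicontinuous — the printed witness family, PROVED

J. Alper, T. Bogart, M. Velasco, *A lower bound for the determinantal complexity of a
hypersurface*, Found. Comput. Math. 17 (2017) 829–836, arXiv:1505.02205 (held
`paper:arxiv-1505.02205`, text p0004 L9–12), **Remark 1.9**: "since `dc(xy²+yt²+z³) > 3`, one
sees that the determinantal complexity function `f ↦ dc(f)` is not in general upper
semicontinuous (i.e. the locus of forms `f` with `dc(f) ≥ m` for a fixed `m` is not necessarily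
Zariski-closed). Indeed, the cubic surface `xy²+yt²+z³` degenerates to singular cubic surfaces
(e.g. `z³ = lim_{ε→0} εxy² + εyt² + z³`) with determinantal complexity `3`. Nevertheless, for
each `m`, the locus of forms `f` with `dc(f) = m` is constructible."

TYPED: the printed WITNESS FAMILY as a concrete statement about the one-parameter family
`f_ε = ε·(xy² + yt²) + z³` (`alperBogartVelasco2017_rem_1_9_witness`): for every `ε ≠ 0`, `dc(f_ε) = 5`
(so `f_ε` lies in the locus `{dc ≥ 4}`), while `f_0 = z³` has `dc = 3`.  NOT typed: the phrase
"not Zariski-closed" itself (the tree's `dc` vocabulary has no Zariski topology on the space of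
forms) and the second sentence (constructibility of `{dc = m}`, Chevalley).

Proof: for `ε ≠ 0` the diagonal substitution `(x, y, z, t) ↦ (εx, ε⁻¹y, z, t)` turns `f_ε`
into `xy²+yt²+z³` and its inverse turns `xy²+yt²+z³` back into `f_ε`; affine substitutions do
not raise `dc` (`determinantalComplexity_aeval_le_of_totalDegree_le_one`, the argument of the tree's
`HasDetRepr.of_isProjection_holds`), so `dc(f_ε) = dc(xy²+yt²+z³) = 5` by ABV Thm. 1.8
(`alperBogartVelasco2017_thm_1_8_holds`, `ABV17CubicSurfaceProofs.lean`); `dc(z³) = 3` by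
`z³ = det diag(z, z, z)` and the degree bound `deg ≤ dc`.

Honest framing: V0 dictionary completion of row ABV2017-A (the last untyped numbered item of
the source); no rung of the Valiant ladder moves; VP ≠ VNP is NOT proved.

## References

* [AlperBogartVelasco2017] J. Alper, T. Bogart, M. Velasco, Found. Comput. Math. 17 (2017)
  829–836, doi:10.1007/s10208-015-9300-x, arXiv:1505.02205 — Remark 1.9 (p0004 L9–12),
  Theorem 1.8.
-/

noncomputable section

open Matrix MvPolynomial

namespace Literature.Computability.AlgebraicComplexity

section Plumbing

variable {k : Type*} [CommRing k] {σ τ : Type*}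

/-- **Affine substitutions keep determinantal expressions of each size**, over any commutative
ring: if `f = det A` with affine entries and every `a i` has total degree `≤ 1`, then
`f(a) = det A(a)` with affine entries (entrywise substitution,
`HasDetRepr.totalDegree_aeval_le_of_le_one`, `AlgHom.map_det`).  General-coefficient form of
the tree's `ℂ`-only `hasDetRepr_aeval_linear` (`LMR13BoundaryFormDcThree.lean`); the argument of
`HasDetRepr.of_isProjection_holds`. [cite: Burgisser2000, §2.5] -/
theorem HasDetRepr.aeval_of_totalDegree_le_one {f : MvPolynomial σ k} {m : ℕ} (h : HasDetRepr f m)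
    (a : σ → MvPolynomial τ k) (ha : ∀ i, (a i).totalDegree ≤ 1) :
    HasDetRepr (aeval a f) m := by
  obtain ⟨A, hA, hdet⟩ := h
  refine ⟨(aeval a).mapMatrix A, fun i j => ?_, ?_⟩
  · rw [AlgHom.mapMatrix_apply, Matrix.map_apply]
    exact (HasDetRepr.totalDegree_aeval_le_of_le_one a ha _).trans (hA i j)
  · rw [← AlgHom.map_det, hdet]

/-- **Affine substitutions do not raise `dc`**, over any commutative ring: if every `a i` has
total degree `≤ 1` then `dc (f(a)) ≤ dc f`.  General-coefficient, Literature-side form of the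
Summit-side `ℂ`-only `determinantalComplexity_aeval_affine_le`
(`Theorems/BarrierLeverDefinableEquationsUnipotentTranslates.lean`). [cite: Burgisser2000, §2.5] -/
theorem determinantalComplexity_aeval_le_of_totalDegree_le_one (a : σ → MvPolynomial τ k)
    (ha : ∀ i, (a i).totalDegree ≤ 1) (f : MvPolynomial σ k) :
    determinantalComplexity (aeval a f) ≤ determinantalComplexity f :=
  determinantalComplexity_le_of_hasDetRepr
    ((hasDetRepr_determinantalComplexity_holds f).aeval_of_totalDegree_le_one a ha)

/-- **Scalars do not raise `dc`** (when `dc f ≥ 1`, i.e. for `f ≠ 1`): `dc (c·f) ≤ dc f` —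
multiply the first row of an attained representation by the constant `c`. [cite: Burgisser2000, §2.5] -/
theorem determinantalComplexity_C_mul_le (c : k) (f : MvPolynomial σ k)
    (hf : 1 ≤ determinantalComplexity f) :
    determinantalComplexity (C c * f) ≤ determinantalComplexity f := by
  obtain ⟨A, hA, hdet⟩ := hasDetRepr_determinantalComplexity_holds f
  let i₀ : Fin (determinantalComplexity f) := ⟨0, by omega⟩
  refine determinantalComplexity_le_of_hasDetRepr
    ⟨A.updateRow i₀ ((C c : MvPolynomial σ k) • A i₀), fun i j => ?_, ?_⟩
  · rw [Matrix.updateRow_apply]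
    split_ifs with h
    · rw [Pi.smul_apply, smul_eq_mul]
      refine (totalDegree_mul _ _).trans ?_
      rw [totalDegree_C, zero_add]
      exact hA _ _
    · exact hA i j
  · rw [Matrix.det_updateRow_smul, Matrix.updateRow_eq_self, hdet]

/-- `dc (X_i ^ n) = n` over any field: `X_i ^ n = det diag(X_i, …, X_i)` (`n × n`) and
`deg ≤ dc`. [cite: MignonRessayre2004, §1] -/
theorem determinantalComplexity_X_pow (K : Type*) [Field K] (i : σ) (n : ℕ) :
    determinantalComplexity (X i ^ n : MvPolynomial σ K) = n := by
  apply le_antisymm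
  · refine determinantalComplexity_le_of_hasDetRepr
      ⟨Matrix.diagonal fun _ : Fin n => X i, fun r c => ?_, ?_⟩
    · rw [Matrix.diagonal_apply]
      split_ifs
      · rw [totalDegree_X]
      · rw [totalDegree_zero]; exact Nat.zero_le _
    · rw [Matrix.det_diagonal, Finset.prod_const, Finset.card_univ, Fintype.card_fin]
  · have h := totalDegree_le_determinantalComplexity_holds (X i ^ n : MvPolynomial σ K)
    rwa [totalDegree_X_pow] at h

end Plumbing

/-- **WITNESS FAMILY of Rem. 1.9 — Alper–Bogart–Velasco 2017, Remark 1.9, first sentence, PROVED** (p0004 L9–12: "the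
locus of forms `f` with `dc(f) ≥ m` … is not necessarily Zariski-closed. Indeed, the cubic surface
`xy²+yt²+z³` degenerates to singular cubic surfaces (e.g. `z³ = lim_{ε→0} εxy²+εyt²+z³`) with
determinantal complexity `3`"): over a field of characteristic `0`, every member
`f_ε = ε·(xy²+yt²) + z³` with `ε ≠ 0` of the printed family has `dc(f_ε) = 5`, while the member
`ε = 0`, `z³`, has `dc = 3` (variables `x, y, z, t ↦ 0, 1, 2, 3` as in `abvCubic`).  Typed = the
concrete family; "not upper semicontinuous / not Zariski-closed" and the constructibility of
`{dc = m}` (second sentence) are NOT formalised.  `CharZero K` only because Thm. 1.8 is stated in characteristic `0`; the `z³` half holds over any field (`determinantalComplexity_X_pow`). [cite: AlperBogartVelasco2017, Rem. 1.9 (arXiv text p0004 L9–12)] -/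
theorem alperBogartVelasco2017_rem_1_9_witness (K : Type*) [Field K] [CharZero K] :
    (∀ ε : K, ε ≠ 0 →
      determinantalComplexity (C ε * (X 0 * X 1 ^ 2 + X 1 * X 3 ^ 2) + X 2 ^ 3 :
        MvPolynomial (Fin 4) K) = 5) ∧
    determinantalComplexity (X 2 ^ 3 : MvPolynomial (Fin 4) K) = 3 := by
  have h5 : determinantalComplexity (abvCubic K) = 5 := alperBogartVelasco2017_thm_1_8_holds K
  refine ⟨fun ε hε => ?_, ?_⟩
  · -- the diagonal substitution `(x,y,z,t) ↦ (εx, ε⁻¹y, z, t)` and its inverse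
    let a : Fin 4 → MvPolynomial (Fin 4) K := ![C ε * X 0, C ε⁻¹ * X 1, X 2, X 3]
    let b : Fin 4 → MvPolynomial (Fin 4) K := ![C ε⁻¹ * X 0, C ε * X 1, X 2, X 3]
    have hdeg : ∀ (c : K) (i : Fin 4), (C c * X i : MvPolynomial (Fin 4) K).totalDegree ≤ 1 :=
      fun c i => (totalDegree_mul _ _).trans (by rw [totalDegree_C, totalDegree_X, zero_add])
    have hX1 : ∀ i : Fin 4, (X i : MvPolynomial (Fin 4) K).totalDegree ≤ 1 := fun i => by
      rw [totalDegree_X]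
    have ha : ∀ i, (a i).totalDegree ≤ 1 := by
      intro i
      fin_cases i
      exacts [hdeg _ _, hdeg _ _, hX1 _, hX1 _]
    have hb : ∀ i, (b i).totalDegree ≤ 1 := by
      intro i
      fin_cases i
      exacts [hdeg _ _, hdeg _ _, hX1 _, hX1 _]
    have hCC : (C ε * C ε⁻¹ : MvPolynomial (Fin 4) K) = 1 := by
      rw [← map_mul, mul_inv_cancel₀ hε, C_1]
    -- `f_ε(a) = xy² + yt² + z³`
    have h1 : aeval a (C ε * (X 0 * X 1 ^ 2 + X 1 * X 3 ^ 2) + X 2 ^ 3 : MvPolynomial (Fin 4) K) =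
        abvCubic K := by
      have e0 : a 0 = C ε * X 0 := rfl
      have e1 : a 1 = C ε⁻¹ * X 1 := rfl
      have e2 : a 2 = X 2 := rfl
      have e3 : a 3 = X 3 := rfl
      simp only [abvCubic, map_add, map_mul, map_pow, aeval_C, aeval_X,
        MvPolynomial.algebraMap_eq, e0, e1, e2, e3]
      linear_combination ((C ε * C ε⁻¹ + 1) * X 0 * X 1 ^ 2 + X 1 * X 3 ^ 2) * hCC
    -- `(xy² + yt² + z³)(b) = f_ε`
    have h2 : aeval b (abvCubic K) =
        (C ε * (X 0 * X 1 ^ 2 + X 1 * X 3 ^ 2) + X 2 ^ 3 : MvPolynomial (Fin 4) K) := by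
      have e0 : b 0 = C ε⁻¹ * X 0 := rfl
      have e1 : b 1 = C ε * X 1 := rfl
      have e2 : b 2 = X 2 := rfl
      have e3 : b 3 = X 3 := rfl
      simp only [abvCubic, map_add, map_mul, map_pow, aeval_X, e0, e1, e2, e3]
      linear_combination (C ε * X 0 * X 1 ^ 2) * hCC
    apply le_antisymm
    · rw [← h2]
      exact (determinantalComplexity_aeval_le_of_totalDegree_le_one b hb _).trans h5.le
    · rw [← h5, ← h1]
      exact determinantalComplexity_aeval_le_of_totalDegree_le_one a ha _
  · -- `dc(z³) = 3` (any field)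
    exact determinantalComplexity_X_pow K 2 3

end Literature.Computability.AlgebraicComplexity
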